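import Summits.QuantumFields.YangMills.Theorems.BalabanUVNodesN12AtRecord12TermPinned
import Literature.MathematicalPhysics.QuantumFieldTheory.Balaban1983to89.B15Claim189N0OfRecord

/-!
# BalabanUVNodes ∕ N12 AT THE `N₀`-PINNED (1.89) LAYER ON A LIVE RE-PIN — `λᴺ := (λ.pinRPrime θ₉).pinD189N θ₉ σ s p₁` (dag-n12-e's module 12 `B15Claim189N0OfRecord`): the
# [IV] leaf at the live re-pin's bundle of record for a run in the window with print's number `N₀` OF RECORD and print's FIRST p. 200 condition DISCHARGED
# (sequel of `BalabanUVNodesN12AtRecord12TermPinned` ∕ `…TermPinnedFlow`; Track A, DAG node N12 = [B15, Balaban1989LargeFieldI] CMP 122 (1989) 175; cluster K1′ `StabilityBAtRecordR12e` =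
# stmt-QuantumFields-19903 (rev 15); seat `pub-ymgap-dag-n12-d` g5 (R134 s2; n12-e g4 INTENT-4 cc, pub-ymgap INBOX l.15481), 2026-08-27; count-neutral, NOT a discharge)

HONEST FRAMING.  Count-neutral kernel BOOKKEEPING BY NAME; nothing of Bałaban's asserted — (1.80), the ℍ-leaves (1.90)–(1.97), Proposition 1, the positive mass of the live pre-𝐑
terms, the provisos at the re-pin, print's SECOND p. 200 condition, the window ∕ flow inputs and the β bounds stay DISPLAYED; N12 NOT discharged.

WHY THIS FILE.  dag-n12-e's module 12 `B15Claim189N0OfRecord` (p48xxxx) makes print's number `N₀` an OBJECT OF RECORD per run (`N0OfRecord θ P k` := the least `n ≥ 1` with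
`R(g_{k+1−n}) ≤ L^{n−1}`, p. 200 *«defined by the equation L^{−N₀+1}R_{k−N₀+1} = 1»*), proves `2 ≤ N₀` from the top coupling (`1 < (log g_k⁻²)^r`) and print's FIRST p. 200
condition from ONE threshold `4(2 + (121∕120)²O(1)B₃B₅M⁵) ≤ ((log g_k⁻²)^r)^{(log L₀²)∕(log L)}` (*«γ sufficiently small»*) with `β ≥ 0` along the history, and pins the (1.89) letters at
`N₀ := N0OfRecord θ P (kSel P + 1)`: `ResidW.pinD189N λ θ σ s p₁ = λ.pinD189χ₀ θ (P ↦ ((σ P).pinTerm (s P)).pinNumerics θ.τ9 (N₀(P))) p₁` (`rfl`), with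
`h189_pinD189N_of_h180[_of_flow]`.  Per the n12-e ∕ n12-d SPLIT (Stage-9-generic + module-1 bodies theirs, LIVE RE-PIN mine) this file is module 4 §2 ∕ module 5 §2 at `λᴺ`:
`hN2` and `hN₀` DROP from the live-re-pin leaf's residue in exchange for `hg1` (or `r ≥ 1` + the (2.7)-small window), `hwin`, `hβhist`.
WHAT THIS FILE PROVES (theorems only).
* §1 `new189_pinAllN_one_zero₁₂` — at admissible Stage-12 parameters the (1.80) ∕ (1.89) antecedent at `λᴺ` holds at `(1, 0)` on every run in the window up to `n ≥ kSel P + 1`.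
* §2 `b15Leaf_WOfRecord₁₀_pinAllN_liveRepin_of_massLive_of_h180` — THE [IV] LEAF at the live re-pin's bundle `WOfRecord₁₀ θ₉ λᴺ P`, run in a (2.7)-small window with
  `kSel P < K` (WINDOW form: `hI`, `SmallnessFor`, β-box `BetaUpperH`; `N₀(P) ≥ 2` automatic from the window); displayed residue: `N₀(P) ≤ N`, `N₀(P) ≤ kSel P + 1`, `r ≥ 1`,
  `β ∈ [0, ¼]`, `2 ≤ L₀`, `L₀² ≤ L`, signs, the threshold `hwin`, `β ≥ 0` along the history, print's SECOND condition `hMl`, flow numerics, geometry, the four ℍ-leaves, (1.80).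
* §3 `b15Leaf_WOfRecord₁₀_pinAllN_liveRepin_of_massLive_of_h180_of_flow` — the same WINDOW-FREE (`hg1`, a history in `]0, γ]` with `γ ≤ 1` feeding only `N₀`'s definition, the
  flow inputs `hε0 ∕ hε1 ∕ hflow` displayed).
Both read as N12's pointed row `B15Leaf ((θ₉′.pinW (WOfRecord₁₂ θ₉′ λᴺ)).res.W P)` by `Iff.rfl` (module 1 `b15Leaf_res_W_pinW_iff`) and feed module 4 §3's socket
`nodes₁₂_pointed_liveRepin_pinW_of_leaf` run by run.  On K0a's witness line (`τ9.Nmem = 0`, module 5 §1) `hNN` is unsatisfiable once `N₀(P) ≥ 2` — same census, the (1.89) slot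
stays RAW there.  One finite four-torus programme at fixed `ε`; nothing continuum ∕ ℝ⁴ ∕ OS ∕ mass gap ∕ Clay.  0 `sorry`, 0 `def`, standard axioms.  Filed `--supports` K1′
(19903) `--as helper`.
Sources: [Balaban1989LargeFieldI] (0.2)–(0.6) pp.176–177, p.181, Prop. 1 p.194, (1.80) p.195, (1.82) p.196, (1.88)–(1.89) p.198, pp.199–200; [Balaban1988Convergent] (2.1) p.254,
(2.5)–(2.8) pp.255–256, (2.18) p.257; [Balaban1989LargeFieldII] Thm 1 + (0.1) pp.355–356; [Balaban1987RG1] (1.22) p.264.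
-/

noncomputable section

open MeasureTheory
open scoped Matrix.Norms.L2Operator

namespace Summit.QuantumFields.YangMills.BalabanUVNodes.N12AtRecord12TermPinnedN0
open Literature.MathematicalPhysics.QuantumFieldTheory.Balaban1983to89
open Literature.MathematicalPhysics.QuantumFieldTheory.Balaban1983to89.T4Continuum (T4Family)
open Literature.MathematicalPhysics.QuantumFieldTheory.Balaban1983to89.DagBinding (PrintedCarriers15 B15Leaf)
open Literature.MathematicalPhysics.QuantumFieldTheory.Balaban1983to89.Node00
open FlowStep (prefixOf BetaUpperH)
open B14FlowStep (SmallnessFor)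
open B15Claim189Assembly (Setting189 new189 chiPP dom half)
open B15 (Prop1Printed Ineq180)
open B15.PrelimIntegrations (Ineq191 Ineq195)
open B15Chi124DetSets (E124)
open B15DeterminingSets (MSField)
open B14DomainGeom (Pt)
open B8Eq17ClassAkV1 (plaqsOf)
open GaugeGroup (dist1)
open GaugeField (plaqHol)
open B15Claim189NumericsPin (pinNumerics_h_le_k)
open B15Claim189PrintedConditions (omegaOfChain)
open B15Claim189N0OfRecord (N0OfRecord h189_pinD189N_of_h180 h189_pinD189N_of_h180_of_flow)
open Summit.QuantumFields.YangMills.BalabanUVNodes.N12AtRecord12Pointed (new189_pinAllχ₀_one_zero₁₂)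
open Summit.QuantumFields.YangMills.BalabanUVNodes.N12AtRecord12LiveSelector (b15Leaf_WOfRecord₁₀_pinAllχ₀_liveRepin_of_massLive)

variable {N : ℕ} [NeZero N] {F : T4Family}

/-! ## §1 Non-vacuity at `λᴺ` -/

section NonVacuity
variable (θ : Stage12Params F N) (lam : ResidW F N) (σ : ∀ P : B12.RunParams, Sit189 F N P.K)
  (s : ∀ P : B12.RunParams, SeqOfRecord F θ.ν θ.τ9.M (gOfRecord₁₀ F N θ.toStage9Params P) P.K (lam.kSel P + 1)) (p₁ : ℕ)

/-- **THE DISPLAYS AT `λᴺ` ARE NEVER VACUOUS ON A RUN IN THE WINDOW UP TO `n ≥ kSel P + 1`** (admissible Stage-12 `θ`): `new189 (λᴺ.D189 P) (1, 0)` — module 1's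
`new189_pinAllχ₀_one_zero₁₂` at the `N₀`-pinned situations (`h ≤ k` is `Nat.sub_le`, the top level is `kSel P + 1`). [cite: Balaban1989LargeFieldI, (1.82) p.196, (1.89) p.198; Balaban1988Convergent, (2.4) p.255, (2.12) p.256 (bookkeeping census)] -/
theorem new189_pinAllN_one_zero₁₂ (hθ : θ.Admissible F N) (P : B12.RunParams) {n : ℕ}
    (hI : Step.InInterval θ.γ n (gOfRecord₁₀ F N θ.toStage9Params P)) (hkn : lam.kSel P + 1 ≤ n) :
    new189 (((lam.pinRPrime θ.toStage9Params).pinD189N θ.toStage9Params σ s p₁).D189 P)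
      ((1 : MSField (F.P P.K) (SU N)), fun _ _ => (0 : EuclideanSpace ℝ (Fin (N ^ 2 - 1)))) :=
  new189_pinAllχ₀_one_zero₁₂ θ lam (fun P => ((σ P).pinTerm (s P)).pinNumerics θ.τ9 (N0OfRecord θ.toStage9Params P (lam.kSel P + 1))) p₁ hθ P hI
    (pinNumerics_h_le_k _ _ _) hkn

end NonVacuity

/-! ## §2 The [IV] leaf at the live re-pin's `N₀`-pinned bundle of record, run in a (2.7)-small window: (1.89), `N₀ ≥ 2` and print's first condition discharged -/

section Leaf
variable (Θ : Stage12Params F N) (lam : ResidW F N) (σ : ∀ P : B12.RunParams, Sit189 F N P.K)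
  (s : ∀ P : B12.RunParams, SeqOfRecord F Θ.ν Θ.τ9.M (gOfRecord₁₀ F N (Θ.liveRepin F N).toStage9Params P) P.K (lam.kSel P + 1)) (p₁ : ℕ)

/-- **★ THE [IV] LEAF AT `WOfRecord₁₀ θ₉ λᴺ P` (`θ₉` the live re-pin's Stage-9 tuple), RUN IN A (2.7)-SMALL WINDOW UP TO `kSel P + 1 ≤ K` — NO (1.89) DISPLAY, `N₀` OF RECORD, PRINT'S
FIRST p. 200 CONDITION A THEOREM**: module 2's `b15Leaf_WOfRecord₁₀_pinAllχ₀_liveRepin_of_massLive` at the `N₀`-pinned situations with the `h189` slot SUPPLIED by n12-e's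
`h189_pinD189N_of_h180` (`2 ≤ N₀(P)` from the window by `one_lt_log_pow_of_inInterval`; the first condition from the threshold `hwin` and `β ≥ 0` along the history).  Letters via
`hD` (instantiate `rfl`).  DISPLAYED: `Provisos₁₀` at the re-pin, positive mass of the LIVE terms, Prop. 1, (1.80), the four ℍ-leaves, geometry, `N₀(P) ≤ N`, `N₀(P) ≤ kSel P + 1`,
`r ≥ 1`, numerics ∕ signs, `hwin`, `hβhist`, print's SECOND condition `hMl`, flow numerics `hA₀ S hβ₀ hε10`, window `hI`, β-box `hup`.
[cite: Balaban1989LargeFieldI, (0.2)–(0.6) p.176, p.176 ll.14–16, Prop. 1 (1.78) p.194, (1.80) p.195, (1.88)–(1.89) p.198, pp.199–200; Balaban1988Convergent, (2.1) p.254, (2.5)–(2.8) pp.255–256; Balaban1987RG1, (1.22) p.264] -/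
theorem b15Leaf_WOfRecord₁₀_pinAllN_liveRepin_of_massLive_of_h180 (hP : (Θ.liveRepin F N).toStage9Params.Provisos₁₀) {P : B12.RunParams} (hK : lam.kSel P < P.K)
    {D : Setting189 (F.P P.K) (SU N) (MSField (F.P P.K) (SU N) × ((j : ℕ) → VecField (F.P P.K) j (EuclideanSpace ℝ (Fin (N ^ 2 - 1))))) (Pt (F.P P.K).d)}
    (hD : D = ((lam.pinRPrime (Θ.liveRepin F N).toStage9Params).pinD189N (Θ.liveRepin F N).toStage9Params σ s p₁).D189 P)
    (hmassLive : ∀ a, LiveSeq F N Θ.ν Θ.τ9 P (gOfRecord₁₀ F N (Θ.liveRepin F N).toStage9Params P) (lam.kSel P + 1)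
        (slotsTOfRecord F N Θ.ν Θ.τ9 (EOfRecord₁₀ F N (Θ.liveRepin F N).toStage9Params) (wOfRecord₉ F N (Θ.liveRepin F N).toStage9Params)
          (Θ.liveRepin F N).ppSel P (gOfRecord₁₀ F N (Θ.liveRepin F N).toStage9Params P) (lam.kSel P + 1)) a →
      0 < ∫ V, rterm (repTOfRecord9 F N Θ.ν Θ.τ9 (EOfRecord₁₀ F N (Θ.liveRepin F N).toStage9Params) (wOfRecord₉ F N (Θ.liveRepin F N).toStage9Params)
        (Θ.liveRepin F N).ppSel P (gOfRecord₁₀ F N (Θ.liveRepin F N).toStage9Params P) (lam.kSel P)) a V ∂(fieldMeasure (F.P P.K) (lam.kSel P + 1) (SU N)))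
    (hP1 : Prop1Printed (lam.LF P))
    -- `N₀` of record: levels and `r ≥ 1`
    (hr : 1 ≤ Θ.ν.r)
    (hNN : N0OfRecord (Θ.liveRepin F N).toStage9Params P (lam.kSel P + 1) ≤ Θ.τ9.Nmem)
    (hNk : N0OfRecord (Θ.liveRepin F N).toStage9Params P (lam.kSel P + 1) ≤ lam.kSel P + 1)
    -- residual numerics, signs, the threshold, `β ≥ 0` along the history, print's second condition
    (hβ0 : 0 ≤ (σ P).β) (hβ : (σ P).β ≤ 1 / 4) (hL₀ : 2 ≤ (σ P).L₀) (hL₀L : (σ P).L₀ ^ 2 ≤ ((F.P P.K).L : ℝ))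
    (hB : 0 ≤ (σ P).O1 * (σ P).B₃ * (σ P).B₅) (hδ : 0 ≤ (σ P).δ) (hdist : ∀ p, 0 ≤ (σ P).dist p)
    (hwin : 4 * (2 + (121 / 120) ^ 2 * ((σ P).O1 * (σ P).B₃ * (σ P).B₅ * (Θ.τ9.M : ℝ) ^ 5))
      ≤ ((Real.log (gOfRecord₁₀ F N (Θ.liveRepin F N).toStage9Params P (lam.kSel P + 1) ^ 2)⁻¹) ^ Θ.ν.r) ^
          (Real.log ((σ P).L₀ ^ 2) / Real.log ((F.P P.K).L : ℝ)))
    (hβhist : ∀ j, j < lam.kSel P + 1 →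
      0 ≤ betaOfRecord₁₀ F N (Θ.liveRepin F N).toStage9Params j (prefixOf (gOfRecord₁₀ F N (Θ.liveRepin F N).toStage9Params P) j))
    (hMl : (121 / 120) ^ 2 * ((σ P).O1 * (σ P).B₃ * (σ P).B₅ * (Θ.τ9.M : ℝ) ^ 5) * Real.exp (-(4 * (σ P).δ * (Θ.τ9.M : ℝ))) ≤ 1 / 12)
    -- flow numerics, the run's (2.7)-small window, the β-box bound
    (hA₀ : 0 ≤ Θ.ν.A₀) {β' β₀ : ℝ} {L : ℕ} (S : SmallnessFor Θ.γ β' β₀ L Θ.ν.p₀) (hβ₀ : β₀ ≤ 1 / 2) (hε10 : Θ.γ * p0Profile Θ.ν.A₀ Θ.ν.p₀ Θ.γ ≤ 1 / 10)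
    (hI : Step.InInterval Θ.γ (lam.kSel P + 1) (gOfRecord₁₀ F N (Θ.liveRepin F N).toStage9Params P))
    (hup : BetaUpperH β' Θ.γ (betaOfRecord₁₀ F N (Θ.liveRepin F N).toStage9Params))
    -- located geometry
    (hZk : ∀ m, lam.kSel P + 1 - N0OfRecord (Θ.liveRepin F N).toStage9Params P (lam.kSel P + 1) < m → m < lam.kSel P + 1 →
      (σ P).Zpp (lam.kSel P + 1) ∩ omegaOfChain (s P) m ⊆ omegaOfChain (s P) (m + 1))
    (hgeom : ∀ m, D.k₀ < m → m < D.k → ∀ p ∈ plaqsOf (D.Ω m \ D.Ω (m + 1)), 4 * ((m : ℝ) - D.k₀) * D.M ≤ D.dist p)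
    (hbox : ∀ p ∈ plaqsOf (half D), D.boxOf p ∈ D.halfcubes ∧ p ∈ D.plaqT (D.boxOf p))
    -- the four ℍ-leaves and (1.80)
    (L91h : ∀ U, new189 D U → ∀ p ∈ plaqsOf (half D),
      Ineq191 (dist1 (plaqHol (D.Upp U) p)) (D.devV'' U p) D.α ((D.L ^ D.h)⁻¹) (D.ε D.h) (E124 D.ε D.L D.η D.k D.h))
    (L95 : ∀ U, new189 D U → ∀ p ∈ plaqsOf (half D),
      Ineq195 (D.devV'' U p) (dist1 (plaqHol (D.Uhalf U (D.boxOf p)) p)) D.α ((D.L ^ D.h)⁻¹) (D.ε D.h) (E124 D.ε D.L D.η D.k D.h))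
    (L91 : ∀ U, new189 D U → ∀ j, D.h ≤ j → j ≤ D.k → ∀ p ∈ plaqsOf (dom D j),
      Ineq191 (dist1 (plaqHol (D.Upp U) p)) (D.dev97 U p) D.α ((D.L ^ j)⁻¹) (D.ε j) (E124 D.ε D.L D.η D.k j))
    (L97 : ∀ U, new189 D U → ∀ j, D.h ≤ j → j ≤ D.k → ∀ p ∈ plaqsOf (dom D j),
      Ineq191 (D.dev97 U p) (D.dev0 U p) D.α ((D.L ^ j)⁻¹) (D.ε j) (E124 D.ε D.L D.η D.k j))
    (h180 : ∀ U, new189 D U → ∀ i, D.h ≤ i → i ≤ D.k → ∀ q ∈ plaqsOf (dom D i),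
      Ineq180 (D.dev0 U q) (D.ε D.k) D.η D.B₃ D.B₅ D.M D.δ (D.dist q) D.O1) :
    B15Leaf (WOfRecord₁₀ F N (Θ.liveRepin F N).toStage9Params
      ((lam.pinRPrime (Θ.liveRepin F N).toStage9Params).pinD189N (Θ.liveRepin F N).toStage9Params σ s p₁) P) := by
  subst hD
  exact b15Leaf_WOfRecord₁₀_pinAllχ₀_liveRepin_of_massLive Θ lam
    (fun P => ((σ P).pinTerm (s P)).pinNumerics Θ.τ9 (N0OfRecord (Θ.liveRepin F N).toStage9Params P (lam.kSel P + 1))) p₁ hP hK hmassLive hP1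
    (fun U hU i hi hik q hq => h180 U hU i hi hik q hq)
    (h189_pinD189N_of_h180 (lam := lam.pinRPrime (Θ.liveRepin F N).toStage9Params) (σT := σ) (sT := s) (p₁ := p₁) P rfl hr hNN hNk hβ0 hβ hL₀ hL₀L hB hδ
      hdist hwin hβhist hMl hA₀ S hβ₀ hε10 hI hup hZk hgeom hbox L91h L95 L91 L97 h180)

/-! ## §3 The same WINDOW-FREE (flow inputs displayed; the history in `]0, γ]`, `γ ≤ 1`, feeds only the definition of `N₀`) -/

/-- **★ THE [IV] LEAF AT `WOfRecord₁₀ θ₉ λᴺ P`, run with `kSel P < K`, WINDOW-FREE — NO (1.89) DISPLAY, `N₀` OF RECORD**: as §2 with n12-e's `h189_pinD189N_of_h180_of_flow`: the top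
coupling's `1 < (log g_k⁻²)^r` (`hg1`, gives `N₀(P) ≥ 2`), a history in `]0, γ]` with `γ ≤ 1` (`hIγ`, e.g. the witness lines' `γ = 1∕2`), `β ≥ 0` below `kSel P + 1`, the threshold
`hwin`, and the flow inputs `hε0 ∕ hε1 ∕ hflow` DISPLAYED at the thresholds of record.  Contentful for `Θ.τ9.Nmem ≥ N₀(P) ≥ 2` (not on K0a's `θ₀ˡⁱᵛᵉ`, module 5 §1).
[cite: Balaban1989LargeFieldI, (0.2)–(0.6) p.176, Prop. 1 (1.78) p.194, (1.80) p.195, (1.88)–(1.89) p.198, pp.199–200; Balaban1988Convergent, (2.1) p.254, (2.5)–(2.8) pp.255–256] -/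
theorem b15Leaf_WOfRecord₁₀_pinAllN_liveRepin_of_massLive_of_h180_of_flow (hP : (Θ.liveRepin F N).toStage9Params.Provisos₁₀) {P : B12.RunParams}
    (hK : lam.kSel P < P.K)
    {D : Setting189 (F.P P.K) (SU N) (MSField (F.P P.K) (SU N) × ((j : ℕ) → VecField (F.P P.K) j (EuclideanSpace ℝ (Fin (N ^ 2 - 1))))) (Pt (F.P P.K).d)}
    (hD : D = ((lam.pinRPrime (Θ.liveRepin F N).toStage9Params).pinD189N (Θ.liveRepin F N).toStage9Params σ s p₁).D189 P)
    (hmassLive : ∀ a, LiveSeq F N Θ.ν Θ.τ9 P (gOfRecord₁₀ F N (Θ.liveRepin F N).toStage9Params P) (lam.kSel P + 1)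
        (slotsTOfRecord F N Θ.ν Θ.τ9 (EOfRecord₁₀ F N (Θ.liveRepin F N).toStage9Params) (wOfRecord₉ F N (Θ.liveRepin F N).toStage9Params)
          (Θ.liveRepin F N).ppSel P (gOfRecord₁₀ F N (Θ.liveRepin F N).toStage9Params P) (lam.kSel P + 1)) a →
      0 < ∫ V, rterm (repTOfRecord9 F N Θ.ν Θ.τ9 (EOfRecord₁₀ F N (Θ.liveRepin F N).toStage9Params) (wOfRecord₉ F N (Θ.liveRepin F N).toStage9Params)
        (Θ.liveRepin F N).ppSel P (gOfRecord₁₀ F N (Θ.liveRepin F N).toStage9Params P) (lam.kSel P)) a V ∂(fieldMeasure (F.P P.K) (lam.kSel P + 1) (SU N)))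
    (hP1 : Prop1Printed (lam.LF P))
    -- `N₀` of record
    (hg1 : 1 < (Real.log (gOfRecord₁₀ F N (Θ.liveRepin F N).toStage9Params P (lam.kSel P + 1) ^ 2)⁻¹) ^ Θ.ν.r)
    (hNN : N0OfRecord (Θ.liveRepin F N).toStage9Params P (lam.kSel P + 1) ≤ Θ.τ9.Nmem)
    (hNk : N0OfRecord (Θ.liveRepin F N).toStage9Params P (lam.kSel P + 1) ≤ lam.kSel P + 1)
    -- residual numerics, signs, the threshold, the history, print's second condition
    (hβ0 : 0 ≤ (σ P).β) (hβ : (σ P).β ≤ 1 / 4) (hL₀ : 2 ≤ (σ P).L₀) (hL₀L : (σ P).L₀ ^ 2 ≤ ((F.P P.K).L : ℝ))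
    (hB : 0 ≤ (σ P).O1 * (σ P).B₃ * (σ P).B₅) (hδ : 0 ≤ (σ P).δ) (hdist : ∀ p, 0 ≤ (σ P).dist p)
    (hwin : 4 * (2 + (121 / 120) ^ 2 * ((σ P).O1 * (σ P).B₃ * (σ P).B₅ * (Θ.τ9.M : ℝ) ^ 5))
      ≤ ((Real.log (gOfRecord₁₀ F N (Θ.liveRepin F N).toStage9Params P (lam.kSel P + 1) ^ 2)⁻¹) ^ Θ.ν.r) ^
          (Real.log ((σ P).L₀ ^ 2) / Real.log ((F.P P.K).L : ℝ)))
    {γ : ℝ} (hγ1 : γ ≤ 1) (hIγ : Step.InInterval γ (lam.kSel P + 1) (gOfRecord₁₀ F N (Θ.liveRepin F N).toStage9Params P))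
    (hβhist : ∀ j, j < lam.kSel P + 1 →
      0 ≤ betaOfRecord₁₀ F N (Θ.liveRepin F N).toStage9Params j (prefixOf (gOfRecord₁₀ F N (Θ.liveRepin F N).toStage9Params P) j))
    (hMl : (121 / 120) ^ 2 * ((σ P).O1 * (σ P).B₃ * (σ P).B₅ * (Θ.τ9.M : ℝ) ^ 5) * Real.exp (-(4 * (σ P).δ * (Θ.τ9.M : ℝ))) ≤ 1 / 12)
    -- the flow inputs DISPLAYED at the thresholds of record
    (hε0 : ∀ i, lam.kSel P + 1 - Θ.τ9.Nmem ≤ i → i ≤ lam.kSel P + 1 →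
      0 ≤ epsOfRecord Θ.ν (gOfRecord₁₀ F N (Θ.liveRepin F N).toStage9Params P) i)
    (hε1 : ∀ i, lam.kSel P + 1 - Θ.τ9.Nmem ≤ i → i ≤ lam.kSel P + 1 →
      epsOfRecord Θ.ν (gOfRecord₁₀ F N (Θ.liveRepin F N).toStage9Params P) i ≤ 1 / 10)
    {β₀ : ℝ} (hβ₀0 : 0 ≤ β₀) (hβ₀ : β₀ ≤ 1 / 2)
    (hflow : ∀ j, lam.kSel P + 1 - Θ.τ9.Nmem ≤ j → j < lam.kSel P + 1 →
      epsOfRecord Θ.ν (gOfRecord₁₀ F N (Θ.liveRepin F N).toStage9Params P) (lam.kSel P + 1) ≤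
        (1 + β₀) * Real.sqrt ((lam.kSel P + 1 - j : ℕ) : ℝ) * epsOfRecord Θ.ν (gOfRecord₁₀ F N (Θ.liveRepin F N).toStage9Params P) j)
    -- located geometry
    (hZk : ∀ m, lam.kSel P + 1 - N0OfRecord (Θ.liveRepin F N).toStage9Params P (lam.kSel P + 1) < m → m < lam.kSel P + 1 →
      (σ P).Zpp (lam.kSel P + 1) ∩ omegaOfChain (s P) m ⊆ omegaOfChain (s P) (m + 1))
    (hgeom : ∀ m, D.k₀ < m → m < D.k → ∀ p ∈ plaqsOf (D.Ω m \ D.Ω (m + 1)), 4 * ((m : ℝ) - D.k₀) * D.M ≤ D.dist p)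
    (hbox : ∀ p ∈ plaqsOf (half D), D.boxOf p ∈ D.halfcubes ∧ p ∈ D.plaqT (D.boxOf p))
    -- the four ℍ-leaves and (1.80)
    (L91h : ∀ U, new189 D U → ∀ p ∈ plaqsOf (half D),
      Ineq191 (dist1 (plaqHol (D.Upp U) p)) (D.devV'' U p) D.α ((D.L ^ D.h)⁻¹) (D.ε D.h) (E124 D.ε D.L D.η D.k D.h))
    (L95 : ∀ U, new189 D U → ∀ p ∈ plaqsOf (half D),
      Ineq195 (D.devV'' U p) (dist1 (plaqHol (D.Uhalf U (D.boxOf p)) p)) D.α ((D.L ^ D.h)⁻¹) (D.ε D.h) (E124 D.ε D.L D.η D.k D.h))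
    (L91 : ∀ U, new189 D U → ∀ j, D.h ≤ j → j ≤ D.k → ∀ p ∈ plaqsOf (dom D j),
      Ineq191 (dist1 (plaqHol (D.Upp U) p)) (D.dev97 U p) D.α ((D.L ^ j)⁻¹) (D.ε j) (E124 D.ε D.L D.η D.k j))
    (L97 : ∀ U, new189 D U → ∀ j, D.h ≤ j → j ≤ D.k → ∀ p ∈ plaqsOf (dom D j),
      Ineq191 (D.dev97 U p) (D.dev0 U p) D.α ((D.L ^ j)⁻¹) (D.ε j) (E124 D.ε D.L D.η D.k j))
    (h180 : ∀ U, new189 D U → ∀ i, D.h ≤ i → i ≤ D.k → ∀ q ∈ plaqsOf (dom D i),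
      Ineq180 (D.dev0 U q) (D.ε D.k) D.η D.B₃ D.B₅ D.M D.δ (D.dist q) D.O1) :
    B15Leaf (WOfRecord₁₀ F N (Θ.liveRepin F N).toStage9Params
      ((lam.pinRPrime (Θ.liveRepin F N).toStage9Params).pinD189N (Θ.liveRepin F N).toStage9Params σ s p₁) P) := by
  subst hD
  exact b15Leaf_WOfRecord₁₀_pinAllχ₀_liveRepin_of_massLive Θ lam
    (fun P => ((σ P).pinTerm (s P)).pinNumerics Θ.τ9 (N0OfRecord (Θ.liveRepin F N).toStage9Params P (lam.kSel P + 1))) p₁ hP hK hmassLive hP1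
    (fun U hU i hi hik q hq => h180 U hU i hi hik q hq)
    (h189_pinD189N_of_h180_of_flow (lam := lam.pinRPrime (Θ.liveRepin F N).toStage9Params) (σT := σ) (sT := s) (p₁ := p₁) P rfl hg1 hNN hNk hβ0 hβ hL₀ hL₀L
      hB hδ hdist hwin hγ1 hIγ hβhist hMl hε0 hε1 hβ₀0 hβ₀ hflow hZk hgeom hbox L91h L95 L91 L97 h180)

end Leaf

end Summit.QuantumFields.YangMills.BalabanUVNodes.N12AtRecord12TermPinnedN0

end
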